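import Literature.Topology.FourManifolds.HomotopySpheresSum
import Literature.AlgebraicTopology.SingularHomology.CollapseMap
import Literature.AlgebraicTopology.SingularHomology.FinitePunctureCohomology
import Literature.AlgebraicTopology.SingularHomology.RelativeCupProduct
import Literature.Topology.FourManifolds.IntersectionFormHomotopyInvariance
import Literature.Topology.FourManifolds.CompatibleOrientationRestrict
import Literature.Topology.FourManifolds.DehnSurgeryTubularNbhdProofs
import Mathlib.Analysis.Convex.Contractible
import HarnessLib

/-!
# The cohomology and the intersection form of a connected sum
# (Wall 1964, p. 144: "`H₂(N) ≅ H₂(M₁) ⊕ H₂(M₂)`"; p. 145: intersection numbers "`xx' − yy'`")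

Topic `Literature/Topology/FourManifolds`. C. T. C. Wall, *On simply-connected 4-manifolds*,
J. London Math. Soc. 39 (1964) 141–149, §2, opens the proof of Thm. 2 (isometric forms ⇒
h-cobordant; the tree's named fact
`Literature.Topology.FourManifolds.isHCobordant_of_equivalent_intersectionForm`,
`HCobordismDonaldson.lean`) with: "let `N` be the connected sum of `M₁` and `−M₂`. … We have
`H₂(N) ≅ H₂(M₁) ⊕ H₂(M₂)`" (p. 144) and uses (p. 145) that for pairs `(x, y)`, `(x', y')` "their
intersection number is `xx' − yy'` … [recall (a) that we reversed the orientation of `M₂` …]",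
i.e. the intersection number in `N` is computed summand by summand — the intersection form of a
connected sum is the orthogonal sum of the forms of the summands (R. Kirby, *The topology of 4-manifolds* (1989), Ch. II §1; J. Milnor,
D. Husemoller, *Symmetric bilinear forms* (1973), §V.1; Gompf–Stipsicz (1999), §1.2). This
standard computation had no statement in the tree; it is the input of the PROVED steps
`signature_eq_zero_of_isLatticeDecomposition` ("Since the signatures of `M₁` and `M₂` are equal,
that of `N` is zero") and `Cobordism.IsHCobordism.exists_homotopyEquiv_lagrangian_graph_map`
(the graph `K` of the isometry) of `HCobordismWallConnectedSum.lean`, which take the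
decomposition `(sM, sN)` of `H²(N)/T` and the identity
`Q_N (x, y) = Q_{M₁} (sM x, sM y) − Q_{M₂} (sN x, sN y)` as hypotheses.

This file PROVES it, for the topological gluing data of a connected sum — the tree's
`Literature.Topology.FourManifolds.ConnectedSumNeck n M N P` (`HomotopySpheresSum.lean`: discs
`i₁ : ℝⁿ → M`, `i₂ : ℝⁿ → N`, continuous injections; embeddings `jA : M ∖ {i₁ 0} → P`,
`jB : N ∖ {i₂ 0} → P` with open ranges covering `P`, identifying exactly the points related by
Kervaire–Milnor's `i₁ (t u) ∼ i₂ ((1 − t) u)`, *Groups of homotopy spheres I* (1963), §2) — and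
homological `ℤ`-orientations (`HomologicalOrientation`), through the **collapse maps**
`c_M : P → M`, `c_N : P → N` (Hatcher, *Algebraic Topology* (2002), §3.3, the quotient maps
`M # N → M`, `M # N → N`; here the tree's `collapseMap` of `CollapseMap.lean`):

* `ConnectedSumNeck.collapseLeft` / `collapseRight` — `c_M` is `jA⁻¹` on `range jA ≅ M ∖ {i₁ 0}`
  and crushes the body of `N` to `i₁ 0` (continuous: `collapseMap`); `c_M ∘ jA = ι` the inclusion
  of the open piece (`collapseLeft_comp_jAC`), `c_M (range jB) ⊆ i₁ (B̄)` (`collapseLeft_jB_mem`),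
  hence `(c_M|_{range jB})^* = 0` and `jB^* c_M^* = 0` in positive degrees (the closed disc is
  contractible), `jA^* c_M^* = ι^*`; symmetrically for `c_N` (everything through `d.swap`).
* `ConnectedSumNeck.neckHomeomorph` — the neck `range jA ∩ range jB` is `ℝⁿ ∖ {0}`
  (`jA a ∈ range jB ↔ a ∈ i₁ (B)`, from the tree's `range_bodyMap`), so `Hʲ(neck; ℤ) = 0` for
  `0 < j ≠ n − 1` (`isZero_singularCohomology_neck`, the tree's punctured-space computation).
* `ConnectedSumNeck.collapse_sum_bijective` — **`(a, b) ↦ c_M^* a + c_N^* b : Hᵏ(M; ℤ) ⊕ Hᵏ(N; ℤ)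
  → Hᵏ(M # N; ℤ)` is bijective for `2 ≤ k` with `k, k + 1 ≠ n`** (so for `n = 4`, `k = 2`):
  injective by applying `jA^*`, `jB^*` (restriction to a punctured manifold is injective on `Hᵏ`,
  `2 ≤ k ≠ n`: the tree's `map_subsetIncl_compl_singleton_injective`, `FinitePunctureCohomology.lean`);
  surjective since `jA^* x`, `jB^* x` extend over the punctures (`…_surjective`, `1 ≤ k`,
  `k + 1 ≠ n`) to `a`, `b`, and `x − c_M^* a − c_N^* b` dies on both open pieces, hence vanishes
  by the Mayer–Vietoris sequence in cohomology (`Hᵏ⁻¹(neck) = 0`; the tree's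
  `singularCohomology.eq_zero_of_map_subsetIncl_eq_zero`). Hatcher 2002, §3.1 pp. 203–204, §3.3
  p. 231.
* `ConnectedSumNeck.cupProduct_map_collapseLeft_map_collapseRight` — **the summands are
  orthogonal: `c_M^* a ⌣ c_N^* b = 0` for `deg a, deg b > 0`**: the two classes die on `range jB`
  and `range jA` respectively, so they lift to `H(P, range jB)`, `H(P, range jA)`, whose relative
  cup product (Hatcher 2002, §3.2 p. 209; the tree's `relSingularCohomology.cup`,
  `toAbsolute_cup`, `RelativeCupProduct.lean`) lies in `H(P, P) = 0`
  (`isZero_relSingularCohomology_of_eq_univ`).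
* `ConnectedSumNeck.IsOrientedLeft` / `IsOrientedRight` — the predicates "`jA` (`jB`) carries the
  local `ℤ`-orientation classes of `M` (`N`), restricted to the open piece, to those of `P`"
  (homological orientation preservation); `hasDegree_collapseLeft` / `…Right` — **then `c_M`, `c_N`
  have degree `1`** (`HasDegree μP μM c_M 1`) for `M`, `N` connected: `(c_M)_* [P]` and `[M]`
  restrict to the same local class at a point of the open piece (naturality of
  `Hₙ(X) → Hₙ(X | x)` under the map of pairs `c_M`, `isFundamentalClass_fundamentalClass_holds`)
  and `Hₙ(M) → Hₙ(M | x)` is injective (Hatcher Thm. 3.26(b),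
  `toLocal_injective_of_connectedSpace_holds`).
* `ConnectedSumNeck.freeCollapseSum_bijective` — the sum map is bijective modulo torsion as well
  (linear algebra: `mem_torsion_of_sum_mem_torsion`, `exists_inverse_of_sum_bijective`, written on
  canonical `ℤ`-module structures and exported to the `ModuleCat` carriers `Hᵏ(·; ℤ)/T` by
  `Subsingleton (Module ℤ ·)`, as in `HCobordismWallConnectedSum.lean`).
* `ConnectedSumNeck.intersectionForm_freeCollapseSum(_of_isOriented)`,
  `ConnectedSumNeck.exists_decomposition_intersectionForm` — **the intersection form of the
  connected sum**: for `k + k = n`, `k ≥ 2`, closed connected `M`, `N` and orientations under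
  which `jA`, `jB` are orientation preserving,
  `Q_P (c_M^* a + c_N^* b, c_M^* a' + c_N^* b') = Q_M (a, a') + Q_N (b, b')` (diagonal terms by
  naturality of the form under maps of degree `d`, the tree's `intersectionForm_map_map`; cross
  terms zero), and the components `(sM, sN)` of the inverse of the sum map give
  `Q_P (x, y) = Q_M (sM x, sM y) + Q_N (sN x, sN y)` with `x ↦ (sM x, sN x)` bijective — the
  shape consumed in `HCobordismWallConnectedSum.lean` (with `N` carrying `−ν`,
  `intersectionForm_neg`, this is Wall's `Q_{M₁} ⊕ (−Q_{M₂})`).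
* `IsOrientedConnectedSum.exists_connectedSumNeck_isOriented` — **smooth oriented connected sums
  qualify**: for the tree's smooth `IsOrientedConnectedSum oM oN oP` (`ConnectedSum.lean`; all
  models `𝓡 n`) and homological orientations `μM`, `μN`, `μP` compatible with `oM`, `oN`, `oP`
  (`SmoothOrientation.IsCompatible`, Bredon 1993, VI.7), the gluing data satisfy `IsOrientedLeft`
  and `IsOrientedRight`: the gluing maps are orientation-preserving smooth open embeddings, and
  orientation-preserving local diffeomorphisms carry compatible local classes to compatible local
  classes (the tree's `SmoothOrientation.IsCompatible.map_localClass_eq`,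
  `CompatibleOrientationTransport.lean`, with `IsCompatible.restrictOpens`; the Jacobian of a
  codimension-`0` immersion is invertible, `det_mfderiv_ne_zero_of_isImmersion` from the tree's
  `mfderiv_injective_of_isImmersion`).

Everything is proved; no named fact is introduced (the two `IsOriented…` predicates and the maps
are definitions with bodies). Spaces are in `Type` (the smooth-orientation dictionary and the
finite-puncture lemmas of the tree are), coefficients `ℤ`.

## What this does NOT do

It does not construct the connected sum (the tree's `exists_isConnectedSum_holds`,
`exists_isOrientedConnectedSum_holds` do), nor touch `H¹`, `Hⁿ⁻¹` (where the neck contributes),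
nor treat non-orientable summands; and Wall's Thm. 2 itself remains a named fact — its other
inputs (Thm. 1, Lemma 2, [10], [11], the re-gluing of §2) are separate.

## References

* C. T. C. Wall, *On simply-connected 4-manifolds*, J. London Math. Soc. 39 (1964) 141–149, §2
  pp. 144–145. [WallJLMS1964]
* M. Kervaire, J. Milnor, *Groups of homotopy spheres I*, Ann. of Math. 77 (1963), §2 p. 505.
  [KervaireMilnorAnnals1963]
* A. Hatcher, *Algebraic Topology*, CUP (2002), §3.1 pp. 201, 203–204, §3.2 p. 209, §3.3 pp. 231,
  234, Thm. 3.26, Exercise 7. [HatcherAT2002]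
* J. Milnor, D. Husemoller, *Symmetric bilinear forms*, Springer (1973), §V.1. [MilnorHusemoller1973]
* R. Kirby, *The topology of 4-manifolds*, LNM 1374 (1989), Ch. II §1. [Kirby1989]
* G. E. Bredon, *Topology and Geometry*, GTM 139 (1993), VI.7 Thm. 7.15. [Bredon1993]
-/

open scoped Manifold ContDiff Topology ContinuousMap
open Set Function Metric Topology CategoryTheory CategoryTheory.Limits
open Literature.AlgebraicTopology.SingularHomology

noncomputable section

namespace Literature.Topology.FourManifolds

namespace ConnectedSumNeck

section Basic

variable {n : ℕ} {M N P : Type} [TopologicalSpace M] [T2Space M] [TopologicalSpace N]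
  [T2Space N] [TopologicalSpace P] (d : ConnectedSumNeck n M N P)

/-! ### The gluing maps as continuous maps -/

/-- `jA` as a continuous map on the open piece `M ∖ {i₁ 0}`. [folklore] -/
def jAC : C(puncture d.i₁, P) := ⟨d.jA, d.isEmbedding_jA.continuous⟩

/-- `jB` as a continuous map on the open piece `N ∖ {i₂ 0}`. [folklore] -/
def jBC : C(puncture d.i₂, P) := ⟨d.jB, d.isEmbedding_jB.continuous⟩

/-- Values of `jAC`. [folklore] -/
@[simp] theorem jAC_apply (a : puncture d.i₁) : d.jAC a = d.jA a := rfl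

/-- Values of `jBC`. [folklore] -/
@[simp] theorem jBC_apply (b : puncture d.i₂) : d.jBC b = d.jB b := rfl

/-- Swapping the summands exchanges the gluing maps. [folklore] -/
@[simp] theorem swap_jAC : d.swap.jAC = d.jBC := rfl

/-- Swapping the summands exchanges the gluing maps. [folklore] -/
@[simp] theorem swap_jBC : d.swap.jBC = d.jAC := rfl

/-- The gluing map `jA` identifies `M ∖ {i₁ 0}` with its open range in `P`; read backwards it is
the homeomorphism `range jA ≃ₜ M ∖ {i₁ 0}` fed to the collapse map. [folklore] -/
def rangeHomeomorphA : ↥(range d.jA) ≃ₜ ↥(({d.i₁ 0}ᶜ : Set M)) :=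
  d.isEmbedding_jA.toHomeomorph.symm.trans (Homeomorph.setCongr (coe_puncture d.i₁))

/-- `rangeHomeomorphA (jA a) = a`. [folklore] -/
theorem rangeHomeomorphA_apply_jA (a : puncture d.i₁) :
    (d.rangeHomeomorphA ⟨d.jA a, mem_range_self a⟩ : M) = a := by
  have h1 : (⟨d.jA a, mem_range_self a⟩ : ↥(range d.jA)) = d.isEmbedding_jA.toHomeomorph a := rfl
  rw [rangeHomeomorphA, h1, Homeomorph.trans_apply, Homeomorph.symm_apply_apply]
  rfl

/-- The closed disc `i₁ (B̄) ⊆ M` is contractible (a homeomorphic copy of the closed unit ball,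
`i₁` being a continuous injection of a compact space into a Hausdorff space). [folklore] -/
theorem contractibleSpace_image_closedBall :
    ContractibleSpace ↥(d.i₁ '' closedBall (0 : EuclideanSpace ℝ (Fin n)) 1) := by
  haveI : CompactSpace ↥(closedBall (0 : EuclideanSpace ℝ (Fin n)) 1) :=
    isCompact_iff_compactSpace.mp (isCompact_closedBall 0 1)
  haveI : ContractibleSpace ↥(closedBall (0 : EuclideanSpace ℝ (Fin n)) 1) :=
    (convex_closedBall (0 : EuclideanSpace ℝ (Fin n)) 1).contractibleSpace
      ⟨0, mem_closedBall_self zero_le_one⟩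
  let f : ↥(closedBall (0 : EuclideanSpace ℝ (Fin n)) 1) → M := fun v => d.i₁ v
  have hf : IsClosedEmbedding f :=
    (d.continuous_i₁.comp continuous_subtype_val).isClosedEmbedding
      (d.injective_i₁.comp Subtype.val_injective)
  have hrange : range f = d.i₁ '' closedBall (0 : EuclideanSpace ℝ (Fin n)) 1 := by
    ext x
    simp only [f, mem_range, mem_image, Subtype.exists, exists_prop]
  exact (hf.isEmbedding.toHomeomorph.trans (Homeomorph.setCongr hrange)).contractibleSpace_iff.mp
    inferInstance

end Basic

/-! ### The collapse maps `P → M`, `P → N` -/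

section Collapse

variable {n : ℕ} {M N P : Type} [TopologicalSpace M] [T2Space M] [TopologicalSpace N]
  [T2Space N] [TopologicalSpace P] [T2Space P] (d : ConnectedSumNeck n M N P)

section Left

variable [CompactSpace M]

/-- **The collapse map `c_M : P = M # N → M`**: the inverse of `jA` on `range jA ≅ M ∖ {i₁ 0}`,
and the whole closed piece `P ∖ range jA` (the body of `N`) sent to the centre `i₁ 0` of the disc
of `M` (the quotient map `M # N → (M # N)/(N ∖ disc) = M`; Hatcher 2002, §3.3 Exercise 7 ff. for
the pinch maps, here through the tree's `collapseMap`). Continuous since `range jA` is open, `P`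
is Hausdorff and `M` is compact. [cite: HatcherAT2002, §3.3 Exercise 7] -/
def collapseLeft : C(P, M) :=
  collapseMap d.isOpen_range_jA (d.i₁ 0) d.rangeHomeomorphA

/-- `c_M (jA a) = a`: the collapse map is a left inverse of the gluing map. [folklore] -/
@[simp] theorem collapseLeft_jA (a : puncture d.i₁) : d.collapseLeft (d.jA a) = a := by
  rw [collapseLeft, collapseMap_apply_of_mem _ _ _ (mem_range_self a)]
  exact d.rangeHomeomorphA_apply_jA a

/-- Off `range jA`, the collapse map `c_M` is constant `i₁ 0`. [folklore] -/
theorem collapseLeft_of_not_mem {p : P} (hp : p ∉ range d.jA) : d.collapseLeft p = d.i₁ 0 :=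
  collapseMap_apply_of_not_mem _ _ _ hp

/-- Off the point `jA a`, the collapse map avoids `a`. [folklore] -/
theorem mapsTo_collapseLeft_compl (a : puncture d.i₁) :
    MapsTo d.collapseLeft ({d.jA a}ᶜ : Set P) ({(a : M)}ᶜ : Set M) := by
  intro p hp hpa
  rw [mem_singleton_iff] at hpa
  by_cases hpU : p ∈ range d.jA
  · obtain ⟨a', rfl⟩ := hpU
    rw [collapseLeft_jA] at hpa
    exact hp (by rw [mem_singleton_iff, Subtype.ext hpa])
  · rw [d.collapseLeft_of_not_mem hpU] at hpa
    exact (mem_puncture.1 a.2) hpa.symm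

/-- `c_M ∘ jA` is the inclusion `M ∖ {i₁ 0} ⊆ M`. [folklore] -/
theorem collapseLeft_comp_jAC : d.collapseLeft.comp d.jAC = HomologicalOrientation.valC (puncture d.i₁) := by
  ext a
  exact d.collapseLeft_jA a

/-- **`c_M` maps the piece `range jB` into the closed disc `i₁ (B̄)`**: a point `jB b` on the neck
is `jA (i₁ (t u))` with `0 < t < 1` and goes to `i₁ (t u)`; a point of the body of `N` goes to
`i₁ 0`. [cite: KervaireMilnorAnnals1963, §2 (p. 505)] -/
theorem collapseLeft_jB_mem (b : puncture d.i₂) :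
    d.collapseLeft (d.jB b) ∈ d.i₁ '' closedBall (0 : EuclideanSpace ℝ (Fin n)) 1 := by
  by_cases h : d.jB b ∈ range d.jA
  · obtain ⟨a, ha⟩ := h
    obtain ⟨u, t, hu, ht, hau, -⟩ := (d.rel a b).1 ha
    rw [← ha, collapseLeft_jA, hau]
    refine ⟨t • u, ?_, rfl⟩
    rw [mem_closedBall_zero_iff, norm_smul, hu, mul_one, Real.norm_eq_abs, abs_of_pos ht.1]
    exact ht.2.le
  · rw [d.collapseLeft_of_not_mem h]
    exact ⟨0, mem_closedBall_self zero_le_one, rfl⟩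

/-- **`(c_M|_{range jB})^* = 0` in positive degrees**: restricted to the piece `range jB`, the
collapse map factors through the contractible disc `i₁ (B̄)`, whose positive-degree cohomology
vanishes. [cite: HatcherAT2002, §3.1 p. 201] -/
theorem map_subsetIncl_rangeB_map_collapseLeft {k : ℕ} (hk : k ≠ 0)
    (a : singularCohomology ℤ ℤ M k) :
    singularCohomology.map ℤ ℤ (subsetIncl (range d.jB)) k
      (singularCohomology.map ℤ ℤ d.collapseLeft k a) = 0 := by
  set K : Set M := d.i₁ '' closedBall (0 : EuclideanSpace ℝ (Fin n)) 1
  haveI : ContractibleSpace ↥K := d.contractibleSpace_image_closedBall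
  -- the corestriction of `c_M|_{range jB}` to `K`
  have hmem : ∀ p : ↥(range d.jB), d.collapseLeft p ∈ K := by
    rintro ⟨_, b, rfl⟩
    exact d.collapseLeft_jB_mem b
  let r : C(↥(range d.jB), ↥K) :=
    ⟨fun p => ⟨d.collapseLeft p, hmem p⟩,
      (d.collapseLeft.continuous.comp continuous_subtype_val).subtype_mk _⟩
  have hfac : d.collapseLeft.comp (subsetIncl (range d.jB)) = (subsetIncl K).comp r := by
    ext p
    rfl
  rw [← ModuleCat.comp_apply, ← singularCohomology.map_comp, hfac, singularCohomology.map_comp,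
    ModuleCat.comp_apply]
  have h0 : singularCohomology.map ℤ ℤ (subsetIncl K) k a = 0 :=
    ModuleCat.eq_zero_of_isZero_obj (isZero_singularCohomology_of_contractibleSpace ℤ ℤ (↥K) hk) _
  rw [h0, map_zero]

/-- **`jB^* c_M^* = 0` in positive degrees.** [cite: HatcherAT2002, §3.1 p. 201] -/
theorem map_jBC_map_collapseLeft {k : ℕ} (hk : k ≠ 0) (a : singularCohomology ℤ ℤ M k) :
    singularCohomology.map ℤ ℤ d.jBC k (singularCohomology.map ℤ ℤ d.collapseLeft k a) = 0 := by
  -- `jB` factors through its range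
  let j : C(puncture d.i₂, ↥(range d.jB)) := ⟨fun b => ⟨d.jB b, mem_range_self b⟩,
    d.isEmbedding_jB.continuous.subtype_mk _⟩
  have hfac : d.jBC = (subsetIncl (range d.jB)).comp j := by ext b; rfl
  rw [hfac, singularCohomology.map_comp, ModuleCat.comp_apply,
    d.map_subsetIncl_rangeB_map_collapseLeft hk, map_zero]

/-- **`jA^* c_M^* = ι^*`**, `ι : M ∖ {i₁ 0} ⊆ M` the inclusion of the open piece. [folklore] -/
theorem map_jAC_map_collapseLeft {k : ℕ} (a : singularCohomology ℤ ℤ M k) :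
    singularCohomology.map ℤ ℤ d.jAC k (singularCohomology.map ℤ ℤ d.collapseLeft k a) =
      singularCohomology.map ℤ ℤ (HomologicalOrientation.valC (puncture d.i₁)) k a := by
  rw [← ModuleCat.comp_apply, ← singularCohomology.map_comp, collapseLeft_comp_jAC]

end Left

section Right

variable [CompactSpace N]

/-- **The collapse map `c_N : P = M # N → N`** (the collapse map of the swapped data).
[cite: HatcherAT2002, §3.3 Exercise 7] -/
def collapseRight : C(P, N) :=
  d.swap.collapseLeft

/-- Swapping the summands exchanges the collapse maps. [folklore] -/
@[simp] theorem swap_collapseLeft : d.swap.collapseLeft = d.collapseRight := rfl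

/-- `c_N (jB b) = b`. [folklore] -/
@[simp] theorem collapseRight_jB (b : puncture d.i₂) : d.collapseRight (d.jB b) = b :=
  d.swap.collapseLeft_jA b

/-- Off `range jB`, the collapse map `c_N` is constant `i₂ 0`. [folklore] -/
theorem collapseRight_of_not_mem {p : P} (hp : p ∉ range d.jB) : d.collapseRight p = d.i₂ 0 :=
  d.swap.collapseLeft_of_not_mem hp

/-- `c_N ∘ jB` is the inclusion `N ∖ {i₂ 0} ⊆ N`. [folklore] -/
theorem collapseRight_comp_jBC : d.collapseRight.comp d.jBC = HomologicalOrientation.valC (puncture d.i₂) :=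
  d.swap.collapseLeft_comp_jAC

/-- **`jA^* c_N^* = 0` in positive degrees.** [cite: HatcherAT2002, §3.1 p. 201] -/
theorem map_jAC_map_collapseRight {k : ℕ} (hk : k ≠ 0) (b : singularCohomology ℤ ℤ N k) :
    singularCohomology.map ℤ ℤ d.jAC k (singularCohomology.map ℤ ℤ d.collapseRight k b) = 0 :=
  d.swap.map_jBC_map_collapseLeft hk b

/-- **`(c_N|_{range jA})^* = 0` in positive degrees.** [cite: HatcherAT2002, §3.1 p. 201] -/
theorem map_subsetIncl_rangeA_map_collapseRight {k : ℕ} (hk : k ≠ 0)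
    (b : singularCohomology ℤ ℤ N k) :
    singularCohomology.map ℤ ℤ (subsetIncl (range d.jA)) k
      (singularCohomology.map ℤ ℤ d.collapseRight k b) = 0 :=
  d.swap.map_subsetIncl_rangeB_map_collapseLeft hk b

/-- **`jB^* c_N^* = ι^*`**, `ι : N ∖ {i₂ 0} ⊆ N`. [folklore] -/
theorem map_jBC_map_collapseRight {k : ℕ} (b : singularCohomology ℤ ℤ N k) :
    singularCohomology.map ℤ ℤ d.jBC k (singularCohomology.map ℤ ℤ d.collapseRight k b) =
      singularCohomology.map ℤ ℤ (HomologicalOrientation.valC (puncture d.i₂)) k b :=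
  d.swap.map_jAC_map_collapseLeft b

end Right

section LeftRight

variable [CompactSpace M]

/-- Swapping the summands exchanges the collapse maps. [folklore] -/
@[simp] theorem swap_collapseRight : d.swap.collapseRight = d.collapseLeft := rfl

end LeftRight

end Collapse

/-! ### The neck `range jA ∩ range jB ≅ ℝⁿ ∖ {0}` and its cohomology -/

section Neck

variable {m : ℕ} {M N P : Type} [TopologicalSpace M] [T2Space M] [TopologicalSpace N]
  [T2Space N] [TopologicalSpace P] (d : ConnectedSumNeck (m + 1) M N P)

/-- The open unit disc of `M` reparametrised by the whole model space: `ψ = i₁ ∘ β`, `β` the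
radial homeomorphism `ℝⁿ ≅ B(0, 1)` of Mathlib (`Homeomorph.unitBall`). [folklore] -/
def discMap (v : EuclideanSpace ℝ (Fin (m + 1))) : M :=
  d.i₁ ((Homeomorph.unitBall v : ball (0 : EuclideanSpace ℝ (Fin (m + 1))) 1) :
    EuclideanSpace ℝ (Fin (m + 1)))

/-- `ψ 0 = i₁ 0`. [folklore] -/
theorem discMap_zero : d.discMap 0 = d.i₁ 0 := by
  rw [discMap, Homeomorph.coe_unitBall_apply_zero]

/-- `ψ` is injective. [folklore] -/
theorem discMap_injective : Injective d.discMap := fun _ _ h =>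
  (Homeomorph.unitBall).injective (Subtype.ext (d.injective_i₁ h))

/-- The range of `ψ` is the open disc `i₁ (B)`. [folklore] -/
theorem range_discMap : range d.discMap = d.i₁ '' ball (0 : EuclideanSpace ℝ (Fin (m + 1))) 1 := by
  ext x
  constructor
  · rintro ⟨v, rfl⟩
    exact ⟨_, (Homeomorph.unitBall v).2, rfl⟩
  · rintro ⟨w, hw, rfl⟩
    refine ⟨(Homeomorph.unitBall).symm ⟨w, hw⟩, ?_⟩
    rw [discMap, Homeomorph.apply_symm_apply]

/-- `ψ` is an embedding: `i₁` restricted to the compact closed ball is a closed embedding into the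
Hausdorff `M`, and `β` is a homeomorphism onto the open ball. [folklore] -/
theorem isEmbedding_discMap : IsEmbedding d.discMap := by
  haveI : CompactSpace ↥(closedBall (0 : EuclideanSpace ℝ (Fin (m + 1))) 1) :=
    isCompact_iff_compactSpace.mp (isCompact_closedBall 0 1)
  have hC : IsClosedEmbedding fun w : ↥(closedBall (0 : EuclideanSpace ℝ (Fin (m + 1))) 1) => d.i₁ w :=
    (d.continuous_i₁.comp continuous_subtype_val).isClosedEmbedding
      (d.injective_i₁.comp Subtype.val_injective)
  have hB : IsEmbedding fun w : ↥(ball (0 : EuclideanSpace ℝ (Fin (m + 1))) 1) => d.i₁ w :=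
    hC.isEmbedding.comp (IsEmbedding.inclusion ball_subset_closedBall)
  exact hB.comp (Homeomorph.unitBall).isEmbedding

/-- For `v ≠ 0`, `ψ v` lies in the open piece `M ∖ {i₁ 0}`. [folklore] -/
theorem discMap_mem_puncture {v : EuclideanSpace ℝ (Fin (m + 1))} (hv : v ≠ 0) :
    d.discMap v ∈ puncture d.i₁ := by
  rw [mem_puncture, ← d.discMap_zero]
  exact fun h => hv (d.discMap_injective h)

/-- **The neck map** `ℝⁿ ∖ {0} → P`, `v ↦ jA (ψ v)`. [cite: KervaireMilnorAnnals1963, §2 (p. 505)] -/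
def neckMap (v : ↥(({0}ᶜ : Set (EuclideanSpace ℝ (Fin (m + 1)))))) : P :=
  d.jA ⟨d.discMap v, d.discMap_mem_puncture v.2⟩

/-- The neck map is an embedding. [folklore] -/
theorem isEmbedding_neckMap : IsEmbedding d.neckMap := by
  have h1 : IsEmbedding fun v : ↥(({0}ᶜ : Set (EuclideanSpace ℝ (Fin (m + 1))))) =>
      (⟨d.discMap v, d.discMap_mem_puncture v.2⟩ : puncture d.i₁) := by
    refine (IsEmbedding.subtypeVal.of_comp_iff).1 ?_
    exact d.isEmbedding_discMap.comp IsEmbedding.subtypeVal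
  exact d.isEmbedding_jA.comp h1

/-- **A point `jA a` of the first piece lies in the second piece iff `a` is in the open disc
`i₁ (B)`** (it is then on the neck; Kervaire–Milnor 1963, §2). [cite: KervaireMilnorAnnals1963, §2 (p. 505)] -/
theorem jA_mem_range_jB_iff (a : puncture d.i₁) :
    d.jA a ∈ range d.jB ↔ (a : M) ∈ d.i₁ '' ball (0 : EuclideanSpace ℝ (Fin (m + 1))) 1 := by
  constructor
  · intro h
    by_contra ha
    have hb : d.jA a ∈ range d.bodyMap := ⟨⟨a, ha⟩, rfl⟩
    rw [d.range_bodyMap] at hb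
    exact hb h
  · intro ha
    by_contra h
    have hb : d.jA a ∈ (range d.jB)ᶜ := h
    rw [← d.range_bodyMap] at hb
    obtain ⟨y, hy⟩ := hb
    have hya : (y : M) = a := congrArg Subtype.val (d.isEmbedding_jA.injective hy)
    exact y.2 (hya ▸ ha)

/-- **The range of the neck map is `range jA ∩ range jB`.** [cite: KervaireMilnorAnnals1963, §2 (p. 505)] -/
theorem range_neckMap : range d.neckMap = range d.jA ∩ range d.jB := by
  ext p
  constructor
  · rintro ⟨v, rfl⟩
    refine ⟨mem_range_self _, (d.jA_mem_range_jB_iff _).2 ?_⟩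
    change d.discMap v ∈ _
    rw [← range_discMap]
    exact mem_range_self _
  · rintro ⟨⟨a, rfl⟩, hB⟩
    obtain ⟨v, hv⟩ : (a : M) ∈ range d.discMap := by
      rw [range_discMap]; exact (d.jA_mem_range_jB_iff a).1 hB
    have hv0 : v ≠ 0 := by
      rintro rfl
      rw [discMap_zero] at hv
      exact (mem_puncture.1 a.2) hv.symm
    refine ⟨⟨v, hv0⟩, ?_⟩
    change d.jA _ = d.jA a
    congr 1
    exact Subtype.ext hv

/-- **The neck of a connected sum is a punctured Euclidean space**:
`ℝⁿ ∖ {0} ≅ range jA ∩ range jB`. [cite: KervaireMilnorAnnals1963, §2 (p. 505)] -/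
def neckHomeomorph :
    ↥(({0}ᶜ : Set (EuclideanSpace ℝ (Fin (m + 1))))) ≃ₜ ↥(range d.jA ∩ range d.jB) :=
  d.isEmbedding_neckMap.toHomeomorph.trans (Homeomorph.setCongr d.range_neckMap)

/-- **`Hʲ(neck; ℤ) = 0` for `0 < j ≠ n - 1`** (`n = m + 1 ≥ 2`): the neck is `ℝⁿ ∖ {0} ≃ Sⁿ⁻¹`
(`isZero_singularCohomology_complZero`). [cite: HatcherAT2002, Cor. 2.14 with Thm. 3.2] -/
theorem isZero_singularCohomology_neck (hm : 1 ≤ m) {j : ℕ} (hj : 0 < j) (hjm : j ≠ m) :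
    IsZero (singularCohomology ℤ ℤ ↥(range d.jA ∩ range d.jB) j) :=
  (isZero_singularCohomology_complZero m hm hj hjm).of_iso
    (singularCohomology.mapIso ℤ ℤ d.neckHomeomorph j)

end Neck

/-! ### `Hᵏ(M # N) ≅ Hᵏ(M) ⊕ Hᵏ(N)` through the collapse maps -/

section Splitting

variable {m : ℕ} {M N P : Type} [TopologicalSpace M] [T2Space M] [TopologicalSpace N]
  [T2Space N] [TopologicalSpace P] (d : ConnectedSumNeck (m + 1) M N P)

/-- `jA` is the inclusion of its range preceded by the homeomorphism onto the range. [folklore] -/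
theorem jAC_eq_comp : d.jAC = (subsetIncl (range d.jA)).comp
    (d.isEmbedding_jA.toHomeomorph : C(puncture d.i₁, ↥(range d.jA))) := by
  ext a; rfl

/-- `jB` is the inclusion of its range preceded by the homeomorphism onto the range. [folklore] -/
theorem jBC_eq_comp : d.jBC = (subsetIncl (range d.jB)).comp
    (d.isEmbedding_jB.toHomeomorph : C(puncture d.i₂, ↥(range d.jB))) :=
  d.swap.jAC_eq_comp

/-- **Mayer–Vietoris, injectivity: a class of `Hᵏ(P)` dying on both pieces is zero**
(`k ≥ 2`, `k ≠ n`: `Hᵏ⁻¹(neck) = 0`). [cite: HatcherAT2002, §3.1 pp. 203–204] -/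
theorem eq_zero_of_map_jAC_eq_zero_of_map_jBC_eq_zero (hm : 1 ≤ m) {k : ℕ} (hk : 2 ≤ k)
    (hkn : k ≠ m + 1) (x : singularCohomology ℤ ℤ P k)
    (hA : singularCohomology.map ℤ ℤ d.jAC k x = 0) (hB : singularCohomology.map ℤ ℤ d.jBC k x = 0) :
    x = 0 := by
  obtain ⟨j, rfl⟩ : ∃ j, k = j + 1 := ⟨k - 1, by omega⟩
  have hZ := d.isZero_singularCohomology_neck hm (j := j) (by omega) (by omega)
  refine singularCohomology.eq_zero_of_map_subsetIncl_eq_zero ℤ d.isOpen_range_jA d.isOpen_range_jB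
    d.union_range hZ x ?_ ?_
  · rw [jAC_eq_comp, singularCohomology.map_comp, ModuleCat.comp_apply] at hA
    exact (ConcreteCategory.injective_of_mono_of_preservesPullback
      (singularCohomology.mapIso ℤ ℤ d.isEmbedding_jA.toHomeomorph (j + 1)).hom)
      (hA.trans (map_zero _).symm)
  · rw [jBC_eq_comp, singularCohomology.map_comp, ModuleCat.comp_apply] at hB
    exact (ConcreteCategory.injective_of_mono_of_preservesPullback
      (singularCohomology.mapIso ℤ ℤ d.isEmbedding_jB.toHomeomorph (j + 1)).hom)
      (hB.trans (map_zero _).symm)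

variable [T2Space P] [ChartedSpace (EuclideanSpace ℝ (Fin (m + 1))) M]
  [ChartedSpace (EuclideanSpace ℝ (Fin (m + 1))) N] [CompactSpace M] [CompactSpace N]

/-- **`Hᵏ(M) ⊕ Hᵏ(N) → Hᵏ(M # N)`, `(a, b) ↦ c_M^* a + c_N^* b`, is injective** for
`2 ≤ k ≠ n`: apply `jA^*`, `jB^*` (`jA^* c_M^* = ι^*` is injective by the finite-puncture lemma,
`jA^* c_N^* = 0`). [cite: WallJLMS1964, §2 p. 144] [cite: HatcherAT2002, §3.1 pp. 203–204, §3.3 p. 231] -/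
theorem collapse_sum_injective (hm : 1 ≤ m) {k : ℕ} (hk : 2 ≤ k) (hkn : k ≠ m + 1) :
    Injective fun ab : singularCohomology ℤ ℤ M k × singularCohomology ℤ ℤ N k =>
      singularCohomology.map ℤ ℤ d.collapseLeft k ab.1 +
        singularCohomology.map ℤ ℤ d.collapseRight k ab.2 := by
  have hk0 : k ≠ 0 := by omega
  have hinjM : Injective (singularCohomology.map ℤ ℤ (HomologicalOrientation.valC (puncture d.i₁)) k) :=
    map_subsetIncl_compl_singleton_injective (by omega) (d.i₁ 0) hk hkn
  have hinjN : Injective (singularCohomology.map ℤ ℤ (HomologicalOrientation.valC (puncture d.i₂)) k) :=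
    map_subsetIncl_compl_singleton_injective (by omega) (d.i₂ 0) hk hkn
  rintro ⟨a, b⟩ ⟨a', b'⟩ h
  simp only at h
  have hA := congrArg (singularCohomology.map ℤ ℤ d.jAC k) h
  simp only [map_add, map_jAC_map_collapseLeft, d.map_jAC_map_collapseRight hk0, add_zero] at hA
  have hB := congrArg (singularCohomology.map ℤ ℤ d.jBC k) h
  simp only [map_add, d.map_jBC_map_collapseLeft hk0, map_jBC_map_collapseRight, zero_add] at hB
  rw [hinjM hA, hinjN hB]

/-- **`Hᵏ(M) ⊕ Hᵏ(N) → Hᵏ(M # N)`, `(a, b) ↦ c_M^* a + c_N^* b`, is surjective** for `2 ≤ k`,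
`k ≠ n`, `k + 1 ≠ n`: for `x ∈ Hᵏ(P)`, `jA^* x` extends over the puncture to `a ∈ Hᵏ(M)` and
`jB^* x` to `b ∈ Hᵏ(N)` (finite-puncture lemma); then `x - c_M^* a - c_N^* b` dies on both pieces,
hence vanishes (Mayer–Vietoris). [cite: WallJLMS1964, §2 p. 144] [cite: HatcherAT2002, §3.1 pp. 203–204, §3.3 p. 231] -/
theorem collapse_sum_surjective (hm : 1 ≤ m) {k : ℕ} (hk : 2 ≤ k) (hkn : k ≠ m + 1)
    (hkn' : k + 1 ≠ m + 1) :
    Surjective fun ab : singularCohomology ℤ ℤ M k × singularCohomology ℤ ℤ N k =>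
      singularCohomology.map ℤ ℤ d.collapseLeft k ab.1 +
        singularCohomology.map ℤ ℤ d.collapseRight k ab.2 := by
  have hk0 : k ≠ 0 := by omega
  intro x
  obtain ⟨a, ha⟩ := map_subsetIncl_compl_singleton_surjective (M := M) (by omega) (d.i₁ 0)
    (k := k) (by omega) hkn' (singularCohomology.map ℤ ℤ d.jAC k x)
  obtain ⟨b, hb⟩ := map_subsetIncl_compl_singleton_surjective (M := N) (by omega) (d.i₂ 0)
    (k := k) (by omega) hkn' (singularCohomology.map ℤ ℤ d.jBC k x)
  refine ⟨(a, b), ?_⟩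
  simp only
  rw [← sub_eq_zero]
  refine (d.eq_zero_of_map_jAC_eq_zero_of_map_jBC_eq_zero hm hk hkn _ ?_ ?_)
  · rw [map_sub, map_add, map_jAC_map_collapseLeft, d.map_jAC_map_collapseRight hk0, add_zero]
    exact sub_eq_zero.2 ha
  · rw [map_sub, map_add, d.map_jBC_map_collapseLeft hk0, map_jBC_map_collapseRight, zero_add]
    exact sub_eq_zero.2 hb

/-- **The cohomology of a connected sum in the middle degrees** (Wall 1964, p. 144:
"`H₂(N) ≅ H₂(M₁) ⊕ H₂(M₂)`"; Kirby 1989, II §1): for `2 ≤ k` with `k, k + 1 ≠ n`,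
`(a, b) ↦ c_M^* a + c_N^* b : Hᵏ(M; ℤ) ⊕ Hᵏ(N; ℤ) → Hᵏ(M # N; ℤ)` is bijective.
[cite: WallJLMS1964, §2 p. 144] [cite: HatcherAT2002, §3.1 pp. 203–204, §3.3 p. 231] -/
theorem collapse_sum_bijective (hm : 1 ≤ m) {k : ℕ} (hk : 2 ≤ k) (hkn : k ≠ m + 1)
    (hkn' : k + 1 ≠ m + 1) :
    Bijective fun ab : singularCohomology ℤ ℤ M k × singularCohomology ℤ ℤ N k =>
      singularCohomology.map ℤ ℤ d.collapseLeft k ab.1 +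
        singularCohomology.map ℤ ℤ d.collapseRight k ab.2 :=
  ⟨d.collapse_sum_injective hm hk hkn, d.collapse_sum_surjective hm hk hkn hkn'⟩

end Splitting

end ConnectedSumNeck

/-! ### `Hᵏ(X, X) = 0` -/

/-- **Relative cohomology of the pair `(X, X)` vanishes**: a relative cochain of `(X, X)` kills
every simplex, so the relative cochain complex is zero. [cite: HatcherAT2002, §3.1 p. 199] -/
theorem isZero_relSingularCohomology_of_eq_univ (R : Type) [CommRing R] {X : Type}
    [TopologicalSpace X] {A : Set X} (hA : A = univ) (k : ℕ) :
    IsZero (relSingularCohomology R R X A k) := by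
  subst hA
  have hX : IsZero ((relCochainComplex R R (univ : Set X)).X k) := by
    refine @ModuleCat.isZero_of_subsingleton _ _ _ ⟨fun φ ψ => Subtype.ext (funext fun σ => ?_)⟩
    exact (φ.2 σ (subset_univ _)).trans (ψ.2 σ (subset_univ _)).symm
  exact (HomologicalComplex.ExactAt.of_isZero hX).isZero_homology

namespace ConnectedSumNeck

/-! ### The two summands are orthogonal: `c_M^* a ⌣ c_N^* b = 0` -/

section CrossTerms

variable {n : ℕ} {M N P : Type} [TopologicalSpace M] [T2Space M] [TopologicalSpace N]
  [T2Space N] [TopologicalSpace P] [T2Space P] (d : ConnectedSumNeck n M N P)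
  [CompactSpace M] [CompactSpace N]

/-- **Classes coming from the two summands have zero cup product**: for `a ∈ Hᵖ(M)`,
`b ∈ Hᵠ(N)` with `p, q > 0`, `c_M^* a ⌣ c_N^* b = 0` in `Hᵖ⁺ᵠ(M # N)`. Indeed `c_M^* a` dies on
the open piece `V = range jB` and `c_N^* b` on `U = range jA`, so they lift to `Hᵖ(P, V)` and
`Hᵠ(P, U)` (exact sequences of the pairs), whose relative cup product lies in
`Hᵖ⁺ᵠ(P, U ∪ V) = Hᵖ⁺ᵠ(P, P) = 0` and maps to `c_M^* a ⌣ c_N^* b` (Hatcher 2002, §3.2 p. 209, the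
relative cup product for open subsets). [cite: HatcherAT2002, §3.2 p. 209] [cite: WallJLMS1964, §2 p. 144] -/
theorem cupProduct_map_collapseLeft_map_collapseRight {p q k : ℕ} (hp : p ≠ 0) (hq : q ≠ 0)
    (h : p + q = k) (a : singularCohomology ℤ ℤ M p) (b : singularCohomology ℤ ℤ N q) :
    cupProduct h (singularCohomology.map ℤ ℤ d.collapseLeft p a)
      (singularCohomology.map ℤ ℤ d.collapseRight q b) = 0 := by
  -- lifts to the relative groups
  obtain ⟨α, hα⟩ := ((ShortComplex.moduleCat_exact_iff _).mp
    (relSingularCohomology.exact_toAbsolute_map (R := ℤ) (M := ℤ) (range d.jB) p)) _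
    (d.map_subsetIncl_rangeB_map_collapseLeft hp a)
  obtain ⟨β, hβ⟩ := ((ShortComplex.moduleCat_exact_iff _).mp
    (relSingularCohomology.exact_toAbsolute_map (R := ℤ) (M := ℤ) (range d.jA) q)) _
    (d.map_subsetIncl_rangeA_map_collapseRight hq b)
  change relSingularCohomology.toAbsolute ℤ ℤ P (range d.jB) p α = _ at hα
  change relSingularCohomology.toAbsolute ℤ ℤ P (range d.jA) q β = _ at hβ
  -- the relative cup product lives in `H(P, P) = 0`
  have key := relSingularCohomology.toAbsolute_cup d.isOpen_range_jB d.isOpen_range_jA h α β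
  rw [hα, hβ] at key
  rw [← key]
  have hU : range d.jB ∪ range d.jA = univ := (union_comm _ _).trans d.union_range
  rw [ModuleCat.eq_zero_of_isZero_obj (isZero_relSingularCohomology_of_eq_univ ℤ hU k)
    (relSingularCohomology.cup d.isOpen_range_jB d.isOpen_range_jA h α β), map_zero]

/-- **Symmetrically, `c_N^* b ⌣ c_M^* a = 0`.** [cite: HatcherAT2002, §3.2 p. 209] -/
theorem cupProduct_map_collapseRight_map_collapseLeft {p q k : ℕ} (hp : p ≠ 0) (hq : q ≠ 0)
    (h : p + q = k) (b : singularCohomology ℤ ℤ N p) (a : singularCohomology ℤ ℤ M q) :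
    cupProduct h (singularCohomology.map ℤ ℤ d.collapseRight p b)
      (singularCohomology.map ℤ ℤ d.collapseLeft q a) = 0 :=
  d.swap.cupProduct_map_collapseLeft_map_collapseRight hp hq h b a

end CrossTerms

/-! ### Orientations and the degree of the collapse maps -/

section Degree

variable {n : ℕ} {M N P : Type} [TopologicalSpace M] [T2Space M] [TopologicalSpace N]
  [T2Space N] [TopologicalSpace P] (d : ConnectedSumNeck n M N P)

/-- The induced map on relative homology only depends on the underlying map of pairs (as in
`TripleSequence.lean`, restated to keep the imports of this file small). [folklore] -/
private theorem relHomologyMap_congr_aux {X Y : Type} [TopologicalSpace X] [TopologicalSpace Y]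
    {A : Set X} {B : Set Y} {f f' : C(X, Y)} (h : f = f') (hf : MapsTo f A B)
    (hf' : MapsTo f' A B) (k : ℕ) :
    relativeSingularHomology.map ℤ ℤ f hf k = relativeSingularHomology.map ℤ ℤ f' hf' k := by
  subst h
  rfl

section DefLeft

variable [ChartedSpace (EuclideanSpace ℝ (Fin n)) M]

/-- **`jA` is orientation preserving from `(M, μM)` to `(P, μP)`** (homological form): at every
point `a` of the open piece `M ∖ {i₁ 0}`, the gluing map carries the local orientation class of
`M` (restricted to the open piece) to the local orientation class of `P`:
`(jA)_* (μM|_{M ∖ i₁ 0})ₐ = (μP)_{jA a}` in `Hₙ(P | jA a; ℤ)`. A predicate on the gluing data and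
the two orientations (explicit binders), not a statement. For smooth oriented connected sums it is
supplied by the dictionary between smooth and homological orientations
(`SmoothOrientation.IsCompatible.map_localClass_eq`). [cite: HatcherAT2002, §3.3 p. 234] -/
def IsOrientedLeft (μM : HomologicalOrientation ℤ M n) (μP : HomologicalOrientation ℤ P n) : Prop :=
  ∀ a : puncture d.i₁, relativeSingularHomology.map ℤ ℤ d.jAC
    (LocalFamily.mapsTo_compl_pt d.isEmbedding_jA.injective a) n
      ((μM.restrictOpens (puncture d.i₁)).localClass a) = μP.localClass (d.jA a)

end DefLeft

section DefRight

variable [ChartedSpace (EuclideanSpace ℝ (Fin n)) N]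

/-- **`jB` is orientation preserving from `(N, μN)` to `(P, μP)`** (the same predicate for the
swapped data). [cite: HatcherAT2002, §3.3 p. 234] -/
def IsOrientedRight (μN : HomologicalOrientation ℤ N n) (μP : HomologicalOrientation ℤ P n) : Prop :=
  d.swap.IsOrientedLeft μN μP

/-- Unfolding `IsOrientedRight`. [folklore] -/
theorem isOrientedRight_iff (μN : HomologicalOrientation ℤ N n) (μP : HomologicalOrientation ℤ P n) :
    d.IsOrientedRight μN μP ↔ ∀ b : puncture d.i₂, relativeSingularHomology.map ℤ ℤ d.jBC
      (LocalFamily.mapsTo_compl_pt d.isEmbedding_jB.injective b) n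
        ((μN.restrictOpens (puncture d.i₂)).localClass b) = μP.localClass (d.jB b) :=
  Iff.rfl

/-- Swapping the summands exchanges the two predicates. [folklore] -/
@[simp] theorem swap_isOrientedLeft_iff (μN : HomologicalOrientation ℤ N n)
    (μP : HomologicalOrientation ℤ P n) : d.swap.IsOrientedLeft μN μP ↔ d.IsOrientedRight μN μP :=
  Iff.rfl

end DefRight

/-- Swapping the summands exchanges the two predicates. [folklore] -/
@[simp] theorem swap_isOrientedRight_iff [ChartedSpace (EuclideanSpace ℝ (Fin n)) M]
    (μM : HomologicalOrientation ℤ M n) (μP : HomologicalOrientation ℤ P n) :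
    d.swap.IsOrientedRight μM μP ↔ d.IsOrientedLeft μM μP :=
  Iff.rfl

section Left

variable [ChartedSpace (EuclideanSpace ℝ (Fin n)) M] [T2Space P] [CompactSpace M]

/-- **The collapse map carries `(μP)_{jA a}` to `(μM)ₐ`** when `jA` is orientation preserving:
`(c_M)_* (μP)_{jA a} = (c_M ∘ jA)_* (μM|)ₐ = ι_* (μM|)ₐ = (μM)ₐ`. [cite: HatcherAT2002, §3.3 p. 234] -/
theorem map_collapseLeft_localClass {μM : HomologicalOrientation ℤ M n}
    {μP : HomologicalOrientation ℤ P n} (h : d.IsOrientedLeft μM μP) (a : puncture d.i₁)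
    (hc : MapsTo d.collapseLeft ({d.jA a}ᶜ : Set P) ({(a : M)}ᶜ : Set M)) :
    relativeSingularHomology.map ℤ ℤ d.collapseLeft hc n (μP.localClass (d.jA a)) =
      μM.localClass a := by
  rw [← h a, ← ModuleCat.comp_apply, ← relativeSingularHomology.map_comp,
    relHomologyMap_congr_aux d.collapseLeft_comp_jAC _
      (LocalFamily.mapsTo_compl_pt Subtype.val_injective a) n]
  exact HomologicalOrientation.map_val_restrictOpens_localClass μM (puncture d.i₁) a

variable [CompactSpace P] [ChartedSpace (EuclideanSpace ℝ (Fin n)) P]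

/-- **The collapse map `c_M : M # N → M` has degree `1`** for orientations under which `jA` is
orientation preserving, `M` connected (and the open piece nonempty): `(c_M)_* [M # N]` and `[M]`
both restrict to `(μM)ₐ` at a point `a ≠ i₁ 0` — the former by naturality of the local classes
under the map of pairs `c_M : (P, P ∖ jA a) → (M, M ∖ a)` and `map_collapseLeft_localClass` — and
`Hₙ(M) → Hₙ(M | a)` is injective on a closed connected manifold (Hatcher 2002, Thm. 3.26(b)).
[cite: HatcherAT2002, §3.3 Thm. 3.26, Exercise 7] -/
theorem hasDegree_collapseLeft [ConnectedSpace M] {μM : HomologicalOrientation ℤ M n}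
    {μP : HomologicalOrientation ℤ P n} (h : d.IsOrientedLeft μM μP) (a : puncture d.i₁) :
    HasDegree μP μM d.collapseLeft 1 := by
  rw [HasDegree, one_zsmul]
  apply singularHomology.toLocal_injective_of_connectedSpace_holds ℤ ℤ M n (a : M)
  have hc := d.mapsTo_collapseLeft_compl a
  have hnat := relativeSingularHomology.ofAbsolute_comp_map ℤ ℤ d.collapseLeft hc n
  -- `([P] pushed forward) restricted at a = c_* ([P] restricted at jA a)`
  have h1 : singularHomology.toLocal ℤ ℤ (a : M) n
      (singularHomology.map ℤ ℤ d.collapseLeft n μP.fundamentalClass) =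
      relativeSingularHomology.map ℤ ℤ d.collapseLeft hc n
        (singularHomology.toLocal ℤ ℤ (d.jA a) n μP.fundamentalClass) := by
    change (singularHomology.map ℤ ℤ d.collapseLeft n ≫
      relativeSingularHomology.ofAbsolute ℤ ℤ M {(a : M)}ᶜ n) μP.fundamentalClass =
      (relativeSingularHomology.ofAbsolute ℤ ℤ P {d.jA a}ᶜ n ≫
        relativeSingularHomology.map ℤ ℤ d.collapseLeft hc n) μP.fundamentalClass
    rw [hnat]
  rw [h1, HomologicalOrientation.isFundamentalClass_fundamentalClass_holds n μP (d.jA a),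
    d.map_collapseLeft_localClass h a hc,
    HomologicalOrientation.isFundamentalClass_fundamentalClass_holds n μM (a : M)]

end Left

section Right

variable [ChartedSpace (EuclideanSpace ℝ (Fin n)) N] [T2Space P] [CompactSpace N] [CompactSpace P]
  [ChartedSpace (EuclideanSpace ℝ (Fin n)) P]

/-- **The collapse map `c_N : M # N → N` has degree `1`** (for `jB` orientation preserving, `N`
connected). [cite: HatcherAT2002, §3.3 Thm. 3.26, Exercise 7] -/
theorem hasDegree_collapseRight [ConnectedSpace N] {μN : HomologicalOrientation ℤ N n}
    {μP : HomologicalOrientation ℤ P n} (h : d.IsOrientedRight μN μP) (b : puncture d.i₂) :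
    HasDegree μP μN d.collapseRight 1 :=
  d.swap.hasDegree_collapseLeft h b

end Right

end Degree

end ConnectedSumNeck

/-! ### Inverting a sum map (linear algebra) -/

section SumInverse

/-- **Components of the inverse of a bijective sum map** `(a, b) ↦ f a + g b`, canonical
`ℤ`-module structures: linear `s`, `t` with `f (s x) + g (t x) = x`, `s (f a + g b) = a`,
`t (f a + g b) = b`, and `x ↦ (s x, t x)` bijective. [folklore] -/
theorem exists_inverse_of_sum_bijective_canonical {A B C : Type*} [AddCommGroup A] [AddCommGroup B]
    [AddCommGroup C] (f : A →ₗ[ℤ] C) (g : B →ₗ[ℤ] C)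
    (hF : Bijective fun ab : A × B => f ab.1 + g ab.2) :
    ∃ (s : C →ₗ[ℤ] A) (t : C →ₗ[ℤ] B), (∀ x, f (s x) + g (t x) = x) ∧ (∀ a b, s (f a + g b) = a) ∧
      (∀ a b, t (f a + g b) = b) ∧ Bijective fun x => (s x, t x) := by
  have hF' : Bijective (f.coprod g) := hF
  let e := LinearEquiv.ofBijective (f.coprod g) hF'
  have he : ∀ ab : A × B, e ab = f ab.1 + g ab.2 := fun ab => rfl
  refine ⟨(LinearMap.fst ℤ A B).comp e.symm.toLinearMap, (LinearMap.snd ℤ A B).comp e.symm.toLinearMap,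
    fun x => ?_, fun a b => ?_, fun a b => ?_, ?_⟩
  · change f (e.symm x).1 + g (e.symm x).2 = x
    rw [← he, e.apply_symm_apply]
  · change (e.symm (f a + g b)).1 = a
    rw [show f a + g b = e (a, b) from (he (a, b)).symm, e.symm_apply_apply]
  · change (e.symm (f a + g b)).2 = b
    rw [show f a + g b = e (a, b) from (he (a, b)).symm, e.symm_apply_apply]
  · change Bijective fun x => ((e.symm x).1, (e.symm x).2)
    exact e.symm.bijective

/-- **Components of the inverse of a bijective sum map**, arbitrary `Module ℤ` instances (the
`ModuleCat` carriers `Hᵏ(·; ℤ)/T` come with their own). [folklore] -/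
theorem exists_inverse_of_sum_bijective {A B C : Type*} [AddCommGroup A] [iA : Module ℤ A]
    [AddCommGroup B] [iB : Module ℤ B] [AddCommGroup C] [iC : Module ℤ C] (f : A →ₗ[ℤ] C)
    (g : B →ₗ[ℤ] C) (hF : Bijective fun ab : A × B => f ab.1 + g ab.2) :
    ∃ (s : C →ₗ[ℤ] A) (t : C →ₗ[ℤ] B), (∀ x, f (s x) + g (t x) = x) ∧ (∀ a b, s (f a + g b) = a) ∧
      (∀ a b, t (f a + g b) = b) ∧ Bijective fun x => (s x, t x) := by
  obtain rfl : iA = AddCommGroup.toIntModule A := Subsingleton.elim _ _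
  obtain rfl : iB = AddCommGroup.toIntModule B := Subsingleton.elim _ _
  obtain rfl : iC = AddCommGroup.toIntModule C := Subsingleton.elim _ _
  exact exists_inverse_of_sum_bijective_canonical f g hF


/-- **A pair mapped into torsion by a bijective sum map is a torsion pair**, canonical `ℤ`-module
structures: linear maps preserve torsion, applied to the inverse of `(a, b) ↦ f a + g b` and to the
two projections. [folklore] -/
theorem mem_torsion_of_sum_mem_torsion_canonical {A B C : Type*} [AddCommGroup A] [AddCommGroup B]
    [AddCommGroup C] (f : A →ₗ[ℤ] C) (g : B →ₗ[ℤ] C)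
    (hF : Bijective fun ab : A × B => f ab.1 + g ab.2) {a : A} {b : B}
    (h : f a + g b ∈ Submodule.torsion ℤ C) :
    a ∈ Submodule.torsion ℤ A ∧ b ∈ Submodule.torsion ℤ B := by
  have hF' : Bijective (f.coprod g) := hF
  let e := LinearEquiv.ofBijective (f.coprod g) hF'
  have hab : e.symm.toLinearMap (f a + g b) = (a, b) := by
    change e.symm (e (a, b)) = (a, b)
    exact e.symm_apply_apply (a, b)
  have h' := freeCohomology.torsion_le_comap_torsion (R := ℤ) e.symm.toLinearMap h
  rw [Submodule.mem_comap, hab] at h'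
  exact ⟨freeCohomology.torsion_le_comap_torsion (R := ℤ) (LinearMap.fst ℤ A B) h',
    freeCohomology.torsion_le_comap_torsion (R := ℤ) (LinearMap.snd ℤ A B) h'⟩

/-- **A pair mapped into torsion by a bijective sum map is a torsion pair**, arbitrary `Module ℤ`
instances. [folklore] -/
theorem mem_torsion_of_sum_mem_torsion {A B C : Type*} [AddCommGroup A] [iA : Module ℤ A]
    [AddCommGroup B] [iB : Module ℤ B] [AddCommGroup C] [iC : Module ℤ C] (f : A →ₗ[ℤ] C)
    (g : B →ₗ[ℤ] C) (hF : Bijective fun ab : A × B => f ab.1 + g ab.2) {a : A} {b : B}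
    (h : f a + g b ∈ Submodule.torsion ℤ C) :
    a ∈ Submodule.torsion ℤ A ∧ b ∈ Submodule.torsion ℤ B := by
  obtain rfl : iA = AddCommGroup.toIntModule A := Subsingleton.elim _ _
  obtain rfl : iB = AddCommGroup.toIntModule B := Subsingleton.elim _ _
  obtain rfl : iC = AddCommGroup.toIntModule C := Subsingleton.elim _ _
  exact mem_torsion_of_sum_mem_torsion_canonical f g hF h

end SumInverse

namespace ConnectedSumNeck

/-! ### Cohomology modulo torsion and the intersection form of a connected sum -/

section Form

variable {m : ℕ} {M N P : Type} [TopologicalSpace M] [T2Space M] [TopologicalSpace N]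
  [T2Space N] [TopologicalSpace P] [T2Space P] (d : ConnectedSumNeck (m + 1) M N P)
  [CompactSpace M] [CompactSpace N]

/-- The sum map modulo torsion `Hᵏ(M)/T ⊕ Hᵏ(N)/T → Hᵏ(M # N)/T`, `(a, b) ↦ c_M^* a + c_N^* b`,
as a linear map (the product carries Mathlib's product module structure `Prod.instModule` of the
`ModuleCat` carriers; the type is left to inference on purpose). [cite: WallJLMS1964, §2 p. 144] -/
def freeCollapseSum (k : ℕ) :=
  (freeCohomology.map (R := ℤ) d.collapseLeft k).coprod (freeCohomology.map (R := ℤ) d.collapseRight k)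

/-- Values of `freeCollapseSum`. [folklore] -/
@[simp] theorem freeCollapseSum_apply (k : ℕ)
    (ab : ↥(freeCohomology ℤ M k) × ↥(freeCohomology ℤ N k)) :
    (d.freeCollapseSum k) ab = freeCohomology.map (R := ℤ) d.collapseLeft k ab.1 +
      freeCohomology.map (R := ℤ) d.collapseRight k ab.2 :=
  rfl

/-- `freeCollapseSum` on classes. [folklore] -/
theorem freeCollapseSum_mk (k : ℕ) (a : singularCohomology ℤ ℤ M k)
    (b : singularCohomology ℤ ℤ N k) :
    (d.freeCollapseSum k) (freeCohomology.mk a, freeCohomology.mk b) =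
      freeCohomology.mk (singularCohomology.map ℤ ℤ d.collapseLeft k a +
        singularCohomology.map ℤ ℤ d.collapseRight k b) := by
  rw [freeCollapseSum_apply, freeCohomology.map_mk, freeCohomology.map_mk, map_add]

/-- **The intersection form of a connected sum on the two summands** (Wall 1964, p. 145: "their
intersection number is `xx' − yy'` … [recall (a) that we reversed the orientation of `M₂`]" —
for `N = M₁ # (−M₂)`; for the orientation-compatible sum it reads `xx' + yy'`; Kirby 1989,
II §1): if the collapse maps have degrees `d_M`, `d_N`
(`c_* [M # N] = d • [·]`), then for `k + k = n`, `k ≥ 2`,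
`Q_P (c_M^* a + c_N^* b, c_M^* a' + c_N^* b') = d_M Q_M (a, a') + d_N Q_N (b, b')`: the diagonal
terms by naturality of the form under maps of degree `d` (`intersectionForm_map_map`), the cross
terms vanish (`cupProduct_map_collapseLeft_map_collapseRight`). [cite: WallJLMS1964, §2 p. 145] [cite: MilnorHusemoller1973, §V.1] -/
theorem intersectionForm_freeCollapseSum {k : ℕ} (hk : 2 ≤ k) (h : k + k = m + 1)
    (μM : HomologicalOrientation ℤ M (m + 1)) (μN : HomologicalOrientation ℤ N (m + 1))
    (μP : HomologicalOrientation ℤ P (m + 1)) {dM dN : ℤ} (hdM : HasDegree μP μM d.collapseLeft dM)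
    (hdN : HasDegree μP μN d.collapseRight dN)
    (ab ab' : ↥(freeCohomology ℤ M k) × ↥(freeCohomology ℤ N k)) :
    intersectionForm h μP ((d.freeCollapseSum k) ab) ((d.freeCollapseSum k) ab') =
      dM * intersectionForm h μM ab.1 ab'.1 + dN * intersectionForm h μN ab.2 ab'.2 := by
  obtain ⟨x, y⟩ := ab
  obtain ⟨x', y'⟩ := ab'
  have hk0 : k ≠ 0 := by omega
  -- the cross terms vanish
  have hcross₁ : intersectionForm h μP (freeCohomology.map (R := ℤ) d.collapseLeft k x)
      (freeCohomology.map (R := ℤ) d.collapseRight k y') = 0 := by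
    induction x using freeCohomology.induction_on with
    | h a =>
    induction y' using freeCohomology.induction_on with
    | h b =>
      rw [freeCohomology.map_mk, freeCohomology.map_mk, intersectionForm_mk_mk, cupPairing_apply,
        d.cupProduct_map_collapseLeft_map_collapseRight hk0 hk0 h a b, map_zero, LinearMap.zero_apply]
  have hcross₂ : intersectionForm h μP (freeCohomology.map (R := ℤ) d.collapseRight k y)
      (freeCohomology.map (R := ℤ) d.collapseLeft k x') = 0 := by
    induction y using freeCohomology.induction_on with
    | h b =>
    induction x' using freeCohomology.induction_on with
    | h a =>
      rw [freeCohomology.map_mk, freeCohomology.map_mk, intersectionForm_mk_mk, cupPairing_apply,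
        d.cupProduct_map_collapseRight_map_collapseLeft hk0 hk0 h b a, map_zero, LinearMap.zero_apply]
  rw [freeCollapseSum_apply, freeCollapseSum_apply, LinearMap.BilinForm.add_left,
    LinearMap.BilinForm.add_right, LinearMap.BilinForm.add_right, hcross₁, hcross₂, add_zero, zero_add,
    intersectionForm_map_map h μP μM hdM, intersectionForm_map_map h μP μN hdN]

variable [ChartedSpace (EuclideanSpace ℝ (Fin (m + 1))) M]
  [ChartedSpace (EuclideanSpace ℝ (Fin (m + 1))) N]

/-- **`Hᵏ(M)/T ⊕ Hᵏ(N)/T ≅ Hᵏ(M # N)/T` through the collapse maps** (`2 ≤ k`, `k, k + 1 ≠ n`;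
Wall 1964, p. 144; Kirby 1989, II §1): the bijection `collapse_sum_bijective` on integral
cohomology descends to cohomology modulo torsion, a linear bijection carrying torsion onto
torsion. [cite: WallJLMS1964, §2 p. 144] -/
theorem freeCollapseSum_bijective (hm : 1 ≤ m) {k : ℕ} (hk : 2 ≤ k) (hkn : k ≠ m + 1)
    (hkn' : k + 1 ≠ m + 1) : Bijective (d.freeCollapseSum k) := by
  have hF := d.collapse_sum_bijective hm hk hkn hkn'
  constructor
  · -- the kernel is trivial: a pair mapping into the torsion of `Hᵏ(P)` is a torsion pair
    have hker : ∀ z : ↥(freeCohomology ℤ M k) × ↥(freeCohomology ℤ N k),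
        (d.freeCollapseSum k) z = 0 → z = 0 := by
      rintro ⟨x, y⟩ hxy
      induction x using freeCohomology.induction_on with
      | h a =>
      induction y using freeCohomology.induction_on with
      | h b =>
        rw [freeCollapseSum_mk, freeCohomology.mk_eq_zero_iff] at hxy
        obtain ⟨ha, hb⟩ := mem_torsion_of_sum_mem_torsion
          (singularCohomology.map ℤ ℤ d.collapseLeft k).hom
          (singularCohomology.map ℤ ℤ d.collapseRight k).hom hF hxy
        rw [Prod.mk_eq_zero, freeCohomology.mk_eq_zero_iff, freeCohomology.mk_eq_zero_iff]
        exact ⟨ha, hb⟩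
    intro z z' h
    rw [← sub_eq_zero]
    exact hker _ (by rw [map_sub, h, sub_self])
  · intro z
    induction z using freeCohomology.induction_on with
    | h x =>
      obtain ⟨⟨a, b⟩, hab⟩ := hF.2 x
      exact ⟨(freeCohomology.mk a, freeCohomology.mk b), by rw [freeCollapseSum_mk]; exact congrArg _ hab⟩

variable [CompactSpace P] [ChartedSpace (EuclideanSpace ℝ (Fin (m + 1))) P]

/-- A point of the open piece `M ∖ {i₁ 0}` (the disc has more than one point in dimension `≥ 1`).
[folklore] -/
def somePoint : puncture d.i₁ :=
  ⟨d.i₁ (EuclideanSpace.single (0 : Fin (m + 1)) (1 : ℝ)), by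
    rw [mem_puncture]
    intro h
    have h0 := congrArg (fun w : EuclideanSpace ℝ (Fin (m + 1)) => w 0) (d.injective_i₁ h)
    simp at h0⟩

/-- **The intersection form of an oriented connected sum is the orthogonal sum of the forms of
the summands** (Wall 1964, pp. 144–145; Kirby 1989, II §1; Gompf–Stipsicz 1999, §1.2): for
`M`, `N` closed connected, `ℤ`-oriented by `μM`, `μN`, `P = M # N` oriented by `μP` with both
gluing maps orientation preserving (`IsOrientedLeft`, `IsOrientedRight`), and `k + k = n`,
`k ≥ 2`: `Q_P (c_M^* a + c_N^* b, c_M^* a' + c_N^* b') = Q_M (a, a') + Q_N (b, b')` on cohomology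
modulo torsion, where `(a, b) ↦ c_M^* a + c_N^* b` is a linear bijection
(`freeCollapseSum_bijective`). [cite: WallJLMS1964, §2 pp. 144–145] [cite: MilnorHusemoller1973, §V.1] -/
theorem intersectionForm_freeCollapseSum_of_isOriented [ConnectedSpace M] [ConnectedSpace N]
    {k : ℕ} (hk : 2 ≤ k) (h : k + k = m + 1)
    {μM : HomologicalOrientation ℤ M (m + 1)} {μN : HomologicalOrientation ℤ N (m + 1)}
    {μP : HomologicalOrientation ℤ P (m + 1)} (hL : d.IsOrientedLeft μM μP)
    (hR : d.IsOrientedRight μN μP) (ab ab' : ↥(freeCohomology ℤ M k) × ↥(freeCohomology ℤ N k)) :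
    intersectionForm h μP ((d.freeCollapseSum k) ab) ((d.freeCollapseSum k) ab') =
      intersectionForm h μM ab.1 ab'.1 + intersectionForm h μN ab.2 ab'.2 := by
  rw [d.intersectionForm_freeCollapseSum hk h μM μN μP (d.hasDegree_collapseLeft hL d.somePoint)
    (d.hasDegree_collapseRight hR d.swap.somePoint), one_mul, one_mul]

end Form

end ConnectedSumNeck

namespace ConnectedSumNeck

section Decomposition

variable {m : ℕ} {M N P : Type} [TopologicalSpace M] [T2Space M] [TopologicalSpace N]
  [T2Space N] [TopologicalSpace P] [T2Space P] (d : ConnectedSumNeck (m + 1) M N P)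
  [CompactSpace M] [CompactSpace N] [ChartedSpace (EuclideanSpace ℝ (Fin (m + 1))) M]
  [ChartedSpace (EuclideanSpace ℝ (Fin (m + 1))) N] [CompactSpace P]
  [ChartedSpace (EuclideanSpace ℝ (Fin (m + 1))) P]

/-- **`Hᵏ(M # N)/T ≅ Hᵏ(M)/T ⊕ Hᵏ(N)/T` with `Q_{M # N} ≅ Q_M ⊥ Q_N`, decomposition form**
(Wall 1964, p. 144 "`H₂(N) ≅ H₂(M₁) ⊕ H₂(M₂)`", p. 145 "their intersection number is `xx' − yy'`"
for `N = M₁ # (−M₂)`, i.e. `xx' + yy'` for the orientation-compatible sum; Kirby 1989, II §1;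
Milnor–Husemoller 1973, §V.1): for closed connected
`ℤ`-oriented `M`, `N` of dimension `n = k + k`, `k ≥ 2`, and `P = M # N` oriented compatibly
with both gluing maps, there are linear maps `sM : Hᵏ(P)/T → Hᵏ(M)/T`, `sN : Hᵏ(P)/T → Hᵏ(N)/T`
— the components of the inverse of `(a, b) ↦ c_M^* a + c_N^* b` — with
`x = c_M^* (sM x) + c_N^* (sN x)`, `sM (c_M^* a + c_N^* b) = a`, `sN (c_M^* a + c_N^* b) = b`,
`x ↦ (sM x, sN x)` bijective, and `Q_P (x, y) = Q_M (sM x, sM y) + Q_N (sN x, sN y)`.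
[cite: WallJLMS1964, §2 pp. 144–145] [cite: MilnorHusemoller1973, §V.1] -/
theorem exists_decomposition_intersectionForm [ConnectedSpace M] [ConnectedSpace N] (hm : 1 ≤ m)
    {k : ℕ} (hk : 2 ≤ k) (h : k + k = m + 1)
    {μM : HomologicalOrientation ℤ M (m + 1)} {μN : HomologicalOrientation ℤ N (m + 1)}
    {μP : HomologicalOrientation ℤ P (m + 1)} (hL : d.IsOrientedLeft μM μP)
    (hR : d.IsOrientedRight μN μP) :
    ∃ (sM : ↥(freeCohomology ℤ P k) →ₗ[ℤ] ↥(freeCohomology ℤ M k))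
      (sN : ↥(freeCohomology ℤ P k) →ₗ[ℤ] ↥(freeCohomology ℤ N k)),
      (∀ x, freeCohomology.map (R := ℤ) d.collapseLeft k (sM x) +
        freeCohomology.map (R := ℤ) d.collapseRight k (sN x) = x) ∧
      (∀ a b, sM (freeCohomology.map (R := ℤ) d.collapseLeft k a +
        freeCohomology.map (R := ℤ) d.collapseRight k b) = a) ∧
      (∀ a b, sN (freeCohomology.map (R := ℤ) d.collapseLeft k a +
        freeCohomology.map (R := ℤ) d.collapseRight k b) = b) ∧
      Bijective (fun x => (sM x, sN x)) ∧
      ∀ x y, intersectionForm h μP x y =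
        intersectionForm h μM (sM x) (sM y) + intersectionForm h μN (sN x) (sN y) := by
  have hkn : k ≠ m + 1 := by omega
  have hkn' : k + 1 ≠ m + 1 := by omega
  obtain ⟨sM, sN, h1, h2, h3, h4⟩ := exists_inverse_of_sum_bijective
    (freeCohomology.map (R := ℤ) d.collapseLeft k) (freeCohomology.map (R := ℤ) d.collapseRight k)
    (d.freeCollapseSum_bijective hm hk hkn hkn')
  refine ⟨sM, sN, h1, h2, h3, h4, fun x y => ?_⟩
  conv_lhs => rw [← h1 x, ← h1 y]
  exact d.intersectionForm_freeCollapseSum_of_isOriented hk h hL hR (sM x, sN x) (sM y, sN y)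

end Decomposition

end ConnectedSumNeck

/-! ### Smooth oriented connected sums: the gluing maps are homologically orientation preserving -/

section Smooth

variable {n : ℕ}

/-- In codimension `0` the Jacobian determinant of a smooth immersion vanishes nowhere (an
injective linear endomorphism of a finite-dimensional space is invertible; Lee 2013, Prop. 4.1
for the injectivity of the differential, `mfderiv_injective_of_isImmersion`). [folklore] -/
theorem det_mfderiv_ne_zero_of_isImmersion {X Y : Type} [TopologicalSpace X]
    [ChartedSpace (EuclideanSpace ℝ (Fin n)) X] [IsManifold (𝓡 n) ∞ X] [TopologicalSpace Y]
    [ChartedSpace (EuclideanSpace ℝ (Fin n)) Y] [IsManifold (𝓡 n) ∞ Y] {f : X → Y}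
    (hf : Manifold.IsImmersion (𝓡 n) (𝓡 n) ∞ f) (x : X) :
    LinearMap.det (M := EuclideanSpace ℝ (Fin n)) (mfderiv (𝓡 n) (𝓡 n) f x).toLinearMap ≠ 0 := by
  set A : EuclideanSpace ℝ (Fin n) →ₗ[ℝ] EuclideanSpace ℝ (Fin n) :=
    (mfderiv (𝓡 n) (𝓡 n) f x).toLinearMap with hA
  have hinj : Function.Injective A := mfderiv_injective_of_isImmersion hf (by simp) x
  exact ((LinearMap.isUnit_iff_isUnit_det A).1
    ((LinearMap.isUnit_iff_ker_eq_bot A).2 (LinearMap.ker_eq_bot.2 hinj))).ne_zero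

/-- **For a smooth orientation-preserving gluing map, `jA` is homologically orientation
preserving** (`ConnectedSumNeck.IsOrientedLeft`) with respect to the homological orientations
compatible with the smooth ones (Bredon 1993, VI.7, Thm. 7.15: an orientation-preserving local
diffeomorphism carries compatible local classes to compatible local classes — the tree's
`SmoothOrientation.IsCompatible.map_localClass_eq`, applied to `jA` on the open piece with the
restricted orientations `oM|`, `μM|`, compatible by `IsCompatible.restrictOpens`).
[cite: Bredon1993, VI.7 Thm. 7.15] -/
theorem ConnectedSumNeck.isOrientedLeft_of_isOrientationPreserving {M N P : Type}
    [TopologicalSpace M] [T2Space M] [ChartedSpace (EuclideanSpace ℝ (Fin n)) M]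
    [IsManifold (𝓡 n) ∞ M] [TopologicalSpace N] [T2Space N] [TopologicalSpace P]
    [ChartedSpace (EuclideanSpace ℝ (Fin n)) P] [IsManifold (𝓡 n) ∞ P] (d : ConnectedSumNeck n M N P)
    (hjA : Manifold.IsSmoothEmbedding (𝓡 n) (𝓡 n) ∞ d.jA)
    (g : HomologicalOrientation ℤ (EuclideanSpace ℝ (Fin n)) n)
    {oM : SmoothOrientation (𝓡 n) M} {oP : SmoothOrientation (𝓡 n) P}
    {μM : HomologicalOrientation ℤ M n} {μP : HomologicalOrientation ℤ P n}
    (hM : SmoothOrientation.IsCompatible g oM μM) (hP : SmoothOrientation.IsCompatible g oP μP)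
    (hop : IsOrientationPreserving (oM.restrict (puncture d.i₁)) oP d.jA) :
    d.IsOrientedLeft μM μP := fun a =>
  SmoothOrientation.IsCompatible.map_localClass_eq g (hM.restrictOpens (puncture d.i₁)) hP
    d.isEmbedding_jA.continuous d.isEmbedding_jA.injective
    (hjA.contMDiff.mdifferentiable (by simp))
    (det_mfderiv_ne_zero_of_isImmersion hjA.isImmersion) hop a

/-- **For a smooth orientation-preserving gluing map, `jB` is homologically orientation
preserving** (`ConnectedSumNeck.IsOrientedRight`). [cite: Bredon1993, VI.7 Thm. 7.15] -/
theorem ConnectedSumNeck.isOrientedRight_of_isOrientationPreserving {M N P : Type}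
    [TopologicalSpace M] [T2Space M] [TopologicalSpace N] [T2Space N]
    [ChartedSpace (EuclideanSpace ℝ (Fin n)) N] [IsManifold (𝓡 n) ∞ N] [TopologicalSpace P]
    [ChartedSpace (EuclideanSpace ℝ (Fin n)) P] [IsManifold (𝓡 n) ∞ P] (d : ConnectedSumNeck n M N P)
    (hjB : Manifold.IsSmoothEmbedding (𝓡 n) (𝓡 n) ∞ d.jB)
    (g : HomologicalOrientation ℤ (EuclideanSpace ℝ (Fin n)) n)
    {oN : SmoothOrientation (𝓡 n) N} {oP : SmoothOrientation (𝓡 n) P}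
    {μN : HomologicalOrientation ℤ N n} {μP : HomologicalOrientation ℤ P n}
    (hN : SmoothOrientation.IsCompatible g oN μN) (hP : SmoothOrientation.IsCompatible g oP μP)
    (hop : IsOrientationPreserving (oN.restrict (puncture d.i₂)) oP d.jB) :
    d.IsOrientedRight μN μP :=
  d.swap.isOrientedLeft_of_isOrientationPreserving hjB g hN hP hop

/-- **An oriented connected sum carries gluing data both of whose gluing maps are homologically
orientation preserving** (Kervaire–Milnor 1963, §2: in `IsOrientedConnectedSum oM oN oP` the maps
`jA`, `jB` are orientation-preserving smooth open embeddings for `oM|`, `oN|` and `oP`; Bredon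
1993, VI.7 for the passage to the compatible homological orientations `μM`, `μN`, `μP`). So the
cohomology and intersection-form decompositions of this file
(`ConnectedSumNeck.exists_decomposition_intersectionForm`) apply to every oriented connected sum of
closed connected oriented manifolds produced by `exists_isOrientedConnectedSum_holds`.
[cite: KervaireMilnorAnnals1963, §2 (p. 505)] [cite: Bredon1993, VI.7 Thm. 7.15] -/
theorem IsOrientedConnectedSum.exists_connectedSumNeck_isOriented {M N P : Type}
    [TopologicalSpace M] [T2Space M] [ChartedSpace (EuclideanSpace ℝ (Fin n)) M]
    [IsManifold (𝓡 n) ∞ M] [TopologicalSpace N] [T2Space N]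
    [ChartedSpace (EuclideanSpace ℝ (Fin n)) N] [IsManifold (𝓡 n) ∞ N] [TopologicalSpace P]
    [ChartedSpace (EuclideanSpace ℝ (Fin n)) P] [IsManifold (𝓡 n) ∞ P]
    {oM : SmoothOrientation (𝓡 n) M} {oN : SmoothOrientation (𝓡 n) N} {oP : SmoothOrientation (𝓡 n) P}
    (h : IsOrientedConnectedSum oM oN oP) (g : HomologicalOrientation ℤ (EuclideanSpace ℝ (Fin n)) n)
    {μM : HomologicalOrientation ℤ M n} {μN : HomologicalOrientation ℤ N n}
    {μP : HomologicalOrientation ℤ P n} (hM : SmoothOrientation.IsCompatible g oM μM)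
    (hN : SmoothOrientation.IsCompatible g oN μN) (hP : SmoothOrientation.IsCompatible g oP μP) :
    ∃ d : ConnectedSumNeck n M N P, d.IsOrientedLeft μM μP ∧ d.IsOrientedRight μN μP := by
  obtain ⟨i₁, i₂, _, jA, jB, hi₁, hi₂, -, -, ⟨hjA, hAo, hjB, hBo, hU, hR⟩, hoA, hoB⟩ := h
  let d : ConnectedSumNeck n M N P :=
    { i₁ := i₁
      i₂ := i₂
      jA := jA
      jB := jB
      continuous_i₁ := hi₁.isEmbedding.continuous
      injective_i₁ := hi₁.isEmbedding.injective
      continuous_i₂ := hi₂.isEmbedding.continuous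
      injective_i₂ := hi₂.isEmbedding.injective
      isEmbedding_jA := hjA.isEmbedding
      isEmbedding_jB := hjB.isEmbedding
      isOpen_range_jA := hAo
      isOpen_range_jB := hBo
      union_range := hU
      rel := hR }
  exact ⟨d, d.isOrientedLeft_of_isOrientationPreserving hjA g hM hP hoA,
    d.isOrientedRight_of_isOrientationPreserving hjB g hN hP hoB⟩

end Smooth

end Literature.Topology.FourManifolds

end
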